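import Mathlib
import Summits.ResolutionOfSingularities.ResolutionOfSingularities.Theorems.WildQuotientsWildQuotientResolutionJordanFiveTwistedChartDefs
import Summits.ResolutionOfSingularities.ResolutionOfSingularities.Theorems.WildQuotientsWildQuotientResolutionInitialFormInjective
import Summits.ResolutionOfSingularities.ResolutionOfSingularities.Theorems.WildQuotientsWildQuotientResolutionToricExitRootSubstInjective

/-!
# R-T rung (J₅) — the universal twisted chart `ψ₅` is injective (initial-form criterion)

(crux stmt-ResolutionOfSingularities-15640 `WildQuotients.WildQuotientResolution`, line `Sketch`,
sector `|G| = p`; programme «R-T twisted root charts in general» of `L/w45c/CHAIN.md` v7.9 §5;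
res-L1-w45c-plan-1 NAMING 2026-08-27T09:46:51Z («the `twistedChart₅` family … values on the
generators, injectivity, and the intertwining law»); design memo `L/res-L1-w45c-idea-2/RT-J5.md` §4
(«ψ-kernel = 0» listed as NOT yet certified — certified here). [OURS · L1 W4.5c] — NOT a statement of
any manuscript (Hironaka 2017 is consumed nowhere); replaces the role of no printed item. Prover
res-L1-w45c-stub-1. AI-written Lean, kernel-checked; weaker than expert review.)

GENERIC CRITERION (`JordanFour.aeval_injective_of_initialForms`, file `…InitialFormInjective`, J₄ rung): if the
initial forms `g₀ i` of the images `g i` (for weights `w₂` on the target, `w₁ i := deg g₀ i`) define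
an injective substitution, so does `g`.
INSTANCE (`JordanFive.twistedChart_injective`, `2, 3 ∈ kˣ`): with `w₂(l, A, ξ, η₁, η₂) = (3, 2, 2, 1, 0)`
(`l = X b`, `A = X a`, `ξ = X c`, `η₁ = X d`, `η₂ = X e`, passengers `0`) the initial forms of
`ψ₅(x_a), …, ψ₅(x_e)` are `l⁴A, l³, l²ξ, −lη₁/6, η₂` (weights `14, 9, 8, 4, 0`), a monomial map with
injective exponent matrix — injective by `ToricExit.monomialTwist_injective` (pivot `b`, exponent
`3`, twists `e_a = 4, e_c = 2, e_d = 1`) after the unit rescaling `x_d ↦ −x_d/6`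
(`aeval_initial_injective`). Consequence: `ψ₅ : k[x] → k[l, A, ξ, η₁, η₂, passengers]` is an
embedding, so the chart ring `k[l,A,ξ,η₁,η₂]` is generically a degree-`3` (= `[k(x)(l) : k(x)]`,
`l³ = T'/H'`) extension of `ψ₅(k[x])` — the twisted CUBE-ROOT cover (RT-J5 §4 «birational,
generic fibre 1» for the saturated coordinates).
-/

-- single-problem summit: the doubled namespace component `ResolutionOfSingularities` is forced
set_option linter.dupNamespace false

noncomputable section

open MvPolynomial

namespace Summit.ResolutionOfSingularities.ResolutionOfSingularities.Theorems.WildQuotientResolution.JordanFive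

section TwistedChart

/-! ### The J₅ twisted chart is injective -/

variable (k : Type) [Field k] (n : ℕ) (a b c d e : Fin n)
  (hab : a ≠ b) (hac : a ≠ c) (had : a ≠ d) (hae : a ≠ e) (hbc : b ≠ c) (hbd : b ≠ d) (hbe : b ≠ e)
  (hcd : c ≠ d) (hce : c ≠ e) (hde : d ≠ e)

include hab hac had hbc hbd hcd in
/-- **The initial monomial map of `ψ₅` is injective**: `x_a ↦ l⁴A`, `x_b ↦ l³`, `x_c ↦ l²ξ`,
`x_d ↦ −η₁/6 · l`, `x_e ↦ η₂`, `x_i ↦ x_i` — a root substitution (`ToricExit.monomialTwist_injective`,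
pivot `b`, `d = 3`, twists `e_a = 4`, `e_c = 2`, `e_d = 1`) precomposed with the unit rescaling
`x_d ↦ −x_d/6`. [OURS · L1 W4.5c] -/
theorem aeval_initial_injective (h2 : (2 : k) ≠ 0) (h3 : (3 : k) ≠ 0) :
    Function.Injective (aeval (fun i : Fin n =>
      if i = a then X b ^ 4 * X a else if i = b then X b ^ 3 else if i = c then X b ^ 2 * X c
      else if i = d then C (-6⁻¹ : k) * (X b * X d) else (X i : MvPolynomial (Fin n) k)) :
        MvPolynomial (Fin n) k →ₐ[k] MvPolynomial (Fin n) k) := by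
  classical
  have h6 : (6 : k) ≠ 0 := by
    rw [show (6 : k) = 2 * 3 by norm_num]
    exact mul_ne_zero h2 h3
  -- the root substitution `μ` and the rescaling `sc` (with inverse `sc'`)
  let ex : Fin n → ℕ := fun s => if s = a then 4 else if s = c then 2 else if s = d then 1 else 0
  let μ : MvPolynomial (Fin n) k →ₐ[k] MvPolynomial (Fin n) k :=
    aeval fun s => if s = b then X b ^ 3 else X s * X b ^ ex s
  let sc : MvPolynomial (Fin n) k →ₐ[k] MvPolynomial (Fin n) k :=
    aeval fun s => if s = d then C (-6⁻¹ : k) * X d else X s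
  let sc' : MvPolynomial (Fin n) k →ₐ[k] MvPolynomial (Fin n) k :=
    aeval fun s => if s = d then C (-6 : k) * X d else X s
  have hμa : μ (X a) = X a * X b ^ 4 := by simp [μ, ex, hab]
  have hμb : μ (X b) = X b ^ 3 := by simp [μ]
  have hμc : μ (X c) = X c * X b ^ 2 := by simp [μ, ex, Ne.symm hbc, Ne.symm hac]
  have hμd : μ (X d) = X d * X b := by simp [μ, ex, Ne.symm hbd, Ne.symm had, Ne.symm hcd]
  have hμi : ∀ i, i ≠ a → i ≠ b → i ≠ c → i ≠ d → μ (X i) = X i := by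
    intro i hia hib hic hid; simp [μ, ex, hia, hib, hic, hid]
  have hμC : ∀ r : k, μ (C r) = C r := fun r => by
    rw [MvPolynomial.algHom_C, MvPolynomial.algebraMap_eq]
  have hscd : sc (X d) = C (-6⁻¹ : k) * X d := by simp [sc]
  have hsci : ∀ i, i ≠ d → sc (X i) = X i := by intro i hid; simp [sc, hid]
  have hsc'd : sc' (X d) = C (-6 : k) * X d := by simp [sc']
  have hsc'i : ∀ i, i ≠ d → sc' (X i) = X i := by intro i hid; simp [sc', hid]
  have hsc'C : ∀ r : k, sc' (C r) = C r := fun r => by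
    rw [MvPolynomial.algHom_C, MvPolynomial.algebraMap_eq]
  have hμ : Function.Injective μ := ToricExit.monomialTwist_injective k n b 3 (by norm_num) ex
  have hsc : Function.Injective sc := by
    have hinv : ∀ f, sc' (sc f) = f := by
      intro f
      have key : sc'.comp sc = AlgHom.id k _ := by
        refine MvPolynomial.algHom_ext fun i => ?_
        change sc' (sc (X i)) = X i
        by_cases hid : i = d
        · rw [hid, hscd, map_mul, hsc'C, hsc'd, ← mul_assoc, ← map_mul,
            show (-6⁻¹ : k) * -6 = 1 by rw [neg_mul_neg, inv_mul_cancel₀ h6], map_one, one_mul]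
        · rw [hsci i hid, hsc'i i hid]
      exact congrArg (fun φ : MvPolynomial (Fin n) k →ₐ[k] MvPolynomial (Fin n) k => φ f) key
    exact Function.LeftInverse.injective hinv
  have hcomp : (aeval (fun i : Fin n =>
      if i = a then X b ^ 4 * X a else if i = b then X b ^ 3 else if i = c then X b ^ 2 * X c
      else if i = d then C (-6⁻¹ : k) * (X b * X d) else (X i : MvPolynomial (Fin n) k)) :
        MvPolynomial (Fin n) k →ₐ[k] MvPolynomial (Fin n) k) = μ.comp sc := by
    refine MvPolynomial.algHom_ext fun i => ?_
    rw [aeval_X, AlgHom.comp_apply]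
    by_cases hia : i = a
    · rw [hia, if_pos rfl, hsci a had, hμa]; ring
    by_cases hib : i = b
    · rw [hib, if_neg (Ne.symm hab), if_pos rfl, hsci b hbd, hμb]
    by_cases hic : i = c
    · rw [hic, if_neg (Ne.symm hac), if_neg (Ne.symm hbc), if_pos rfl, hsci c hcd, hμc]; ring
    by_cases hid : i = d
    · rw [hid, if_neg (Ne.symm had), if_neg (Ne.symm hbd), if_neg (Ne.symm hcd), if_pos rfl, hscd,
        map_mul, hμC, hμd]; ring
    · rw [if_neg hia, if_neg hib, if_neg hic, if_neg hid, hsci i hid, hμi i hia hib hic hid]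
  rw [hcomp]
  exact hμ.comp hsc

include hab hac had hae hbc hbd hbe hcd hce hde in
/-- **`ψ₅` is injective** (`2, 3 ∈ kˣ`): initial-form criterion with target weights
`(l, A, ξ, η₁, η₂) = (3, 2, 2, 1, 0)`, source weights `(x_a, x_b, x_c, x_d, x_e) = (14, 9, 8, 4, 0)`,
passengers `0`. [OURS · L1 W4.5c] -/
theorem twistedChart_injective (h2 : (2 : k) ≠ 0) (h3 : (3 : k) ≠ 0) :
    Function.Injective (twistedChart k n a b c d e) := by
  classical
  -- weights
  let w₂ : Fin n → ℕ := fun i => if i = b then 3 else if i = a then 2 else if i = c then 2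
    else if i = d then 1 else 0
  let w₁ : Fin n → ℕ := fun i => if i = a then 14 else if i = b then 9 else if i = c then 8
    else if i = d then 4 else 0
  have hwb : w₂ b = 3 := by simp [w₂]
  have hwa : w₂ a = 2 := by simp [w₂, hab]
  have hwc : w₂ c = 2 := by simp [w₂, Ne.symm hbc, Ne.symm hac]
  have hwd : w₂ d = 1 := by simp [w₂, Ne.symm hbd, Ne.symm had, Ne.symm hcd]
  have hwe : w₂ e = 0 := by simp [w₂, Ne.symm hbe, Ne.symm hae, Ne.symm hce, Ne.symm hde]
  have hw0 : ∀ i, i ≠ a → i ≠ b → i ≠ c → i ≠ d → w₂ i = 0 := by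
    intro i hia hib hic hid; simp [w₂, hia, hib, hic, hid]
  have hXa : IsWeightedHomogeneous w₂ (X a : MvPolynomial (Fin n) k) 2 :=
    hwa ▸ isWeightedHomogeneous_X k w₂ a
  have hXb : IsWeightedHomogeneous w₂ (X b : MvPolynomial (Fin n) k) 3 :=
    hwb ▸ isWeightedHomogeneous_X k w₂ b
  have hXc : IsWeightedHomogeneous w₂ (X c : MvPolynomial (Fin n) k) 2 :=
    hwc ▸ isWeightedHomogeneous_X k w₂ c
  have hXd : IsWeightedHomogeneous w₂ (X d : MvPolynomial (Fin n) k) 1 :=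
    hwd ▸ isWeightedHomogeneous_X k w₂ d
  have hXe : IsWeightedHomogeneous w₂ (X e : MvPolynomial (Fin n) k) 0 :=
    hwe ▸ isWeightedHomogeneous_X k w₂ e
  -- initial forms
  let g₀ : Fin n → MvPolynomial (Fin n) k := fun i =>
    if i = a then X b ^ 4 * X a else if i = b then X b ^ 3 else if i = c then X b ^ 2 * X c
    else if i = d then C (-6⁻¹ : k) * (X b * X d) else X i
  have hg₀a : g₀ a = X b ^ 4 * X a := by simp [g₀]
  have hg₀b : g₀ b = X b ^ 3 := by simp [g₀, Ne.symm hab]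
  have hg₀c : g₀ c = X b ^ 2 * X c := by simp [g₀, Ne.symm hac, Ne.symm hbc]
  have hg₀d : g₀ d = C (-6⁻¹ : k) * (X b * X d) := by
    simp [g₀, Ne.symm had, Ne.symm hbd, Ne.symm hcd]
  have hg₀i : ∀ i, i ≠ a → i ≠ b → i ≠ c → i ≠ d → g₀ i = X i := by
    intro i hia hib hic hid; simp [g₀, hia, hib, hic, hid]
  have h₀ : ∀ i, IsWeightedHomogeneous w₂ (g₀ i) (w₁ i) := by
    intro i
    by_cases hia : i = a
    · subst hia
      rw [hg₀a, show w₁ i = 14 by simp [w₁]]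
      exact (hXb.pow 4).mul hXa
    by_cases hib : i = b
    · subst hib
      rw [hg₀b, show w₁ i = 9 by simp [w₁, hia]]
      exact hXb.pow 3
    by_cases hic : i = c
    · subst hic
      rw [hg₀c, show w₁ i = 8 by simp [w₁, hia, hib]]
      exact (hXb.pow 2).mul hXc
    by_cases hid : i = d
    · subst hid
      rw [hg₀d, show w₁ i = 4 by simp [w₁, hia, hib, hic]]
      exact (hXb.mul hXd).C_mul _
    · rw [hg₀i i hia hib hic hid, show w₁ i = 0 by simp [w₁, hia, hib, hic, hid]]
      by_cases hie : i = e
      · subst hie; exact hXe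
      have h := isWeightedHomogeneous_X k w₂ i
      rwa [hw0 i hia hib hic hid] at h
  -- remainders
  have hr : ∀ i d', coeff d' (twistedChartFun k n a b c d e i - g₀ i) ≠ 0 →
      w₁ i + 1 ≤ Finsupp.weight w₂ d' := by
    intro i
    by_cases hia : i = a
    · subst hia
      have e0 : twistedChartFun k n i b c d e i - g₀ i = 0 := by
        rw [hg₀a]; simp [twistedChartFun]
      intro d' hd'; rw [e0, coeff_zero] at hd'; exact absurd rfl hd'
    by_cases hib : i = b
    · subst hib
      have e0 : twistedChartFun k n a i c d e i - g₀ i = X i ^ 3 * X a * X c * 1 := by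
        rw [hg₀b]; simp [twistedChartFun, Ne.symm hab]; ring
      rw [e0, show w₁ i + 1 = 10 by simp [w₁, hia]]
      exact JordanFour.lb_mul_of_isWeightedHomogeneous_left w₂ (((hXb.pow 3).mul hXa).mul hXc) (by norm_num) _
    by_cases hic : i = c
    · subst hic
      have e0 : twistedChartFun k n a b i d e i - g₀ i =
          X b ^ 3 * 1 + X b ^ 2 * X a * (C (2⁻¹ : k) * (X i ^ 2 - X b * X i - X d)) := by
        rw [hg₀c]; simp [twistedChartFun, JordanFour.twistedP, Ne.symm hac, Ne.symm hbc]; ring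
      rw [e0, show w₁ i + 1 = 9 by simp [w₁, hia, hib]]
      refine JordanFour.lb_add w₂ ?_ ?_
      · exact JordanFour.lb_mul_of_isWeightedHomogeneous_left w₂ (hXb.pow 3) (by norm_num) _
      · have h := JordanFour.lb_mul w₂ (JordanFour.lb_of_isWeightedHomogeneous w₂ ((hXb.pow 2).mul hXa) le_rfl)
          (JordanFour.lb_C_mul w₂ (2⁻¹ : k) (JordanFour.lb_sub w₂ (JordanFour.lb_sub w₂
            (JordanFour.lb_of_isWeightedHomogeneous w₂ (hXc.pow 2) (show 1 ≤ 2 • 2 by norm_num))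
            (JordanFour.lb_of_isWeightedHomogeneous w₂ (hXb.mul hXc) (show 1 ≤ 3 + 2 by norm_num)))
            (JordanFour.lb_of_isWeightedHomogeneous w₂ hXd le_rfl)))
        exact JordanFour.lb_mono w₂ (by norm_num) h
    by_cases hid : i = d
    · subst hid
      have e0 : twistedChartFun k n a b c i e i - g₀ i =
          X b * X c * (C (6⁻¹ : k) * (3 * X c + X a * X c ^ 2 - 3 * (X a * X i))) +
            X b ^ 2 * (C (6⁻¹ : k) * (3 * X c + 2 * X b - 3 * (X a * X c ^ 2) +
              2 * (X a * X b * X c))) := by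
        rw [hg₀d]; simp [twistedChartFun, twistedD, Ne.symm had, Ne.symm hbd, Ne.symm hcd]; ring
      rw [e0, show w₁ i + 1 = 5 by simp [w₁, hia, hib, hic]]
      refine JordanFour.lb_add w₂ ?_ ?_
      · exact JordanFour.lb_mul_of_isWeightedHomogeneous_left w₂ (hXb.mul hXc) (by norm_num) _
      · exact JordanFour.lb_mul_of_isWeightedHomogeneous_left w₂ (hXb.pow 2) (by norm_num) _
    by_cases hie : i = e
    · subst hie
      have h24 := twentyFour_mul_C_inv k n h2 h3
      have e0 : twistedChartFun k n a b c d i i - g₀ i =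
          X c * (C (24⁻¹ : k) * (4 * X c ^ 2 + 4 * X b ^ 2 - 4 * X d + X a * (X c ^ 3 -
            6 * (X b * X c ^ 2) + 11 * (X b ^ 2 * X c) - 6 * X b ^ 3 - 6 * (X d * X c) +
            6 * (X b * X d)))) := by
        rw [hg₀i i hia hib hic hid]
        simp only [twistedChartFun, twistedE, if_neg hia, if_neg hib, if_neg hic, if_neg hid,
          if_true]
        linear_combination (X i) * h24
      rw [e0, show w₁ i + 1 = 1 by simp [w₁, hia, hib, hic, hid]]
      exact JordanFour.lb_mul_of_isWeightedHomogeneous_left w₂ hXc (by norm_num) _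
    · have e0 : twistedChartFun k n a b c d e i - g₀ i = 0 := by
        rw [hg₀i i hia hib hic hid]; simp [twistedChartFun, hia, hib, hic, hid, hie]
      intro d' hd'; rw [e0, coeff_zero] at hd'; exact absurd rfl hd'
  exact JordanFour.aeval_injective_of_initialForms w₁ w₂ (twistedChartFun k n a b c d e) g₀ h₀ hr
    (aeval_initial_injective k n a b c d hab hac had hbc hbd hcd h2 h3)

end TwistedChart

end Summit.ResolutionOfSingularities.ResolutionOfSingularities.Theorems.WildQuotientResolution.JordanFive

end
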